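import Literature.Probability.HartmanWatson1974.VonMisesMixture
import Literature.Analysis.SpecialFunctions.BesselHeatKernelNeumannSeries
import Literature.Analysis.SpecialFunctions.BesselIRealOrderContinuity
import Literature.Analysis.Calculus.PowerSeriesNonnegCoeff
import Literature.MeasureTheory.Integral.BernsteinCompletelyMonotoneDeriv
import Mathlib
import HarnessLib

/-!
# The Hartman–Watson theorem: `u ↦ I_{√(2u)}(β)` is completely monotone — discharge of `HartmanWatsonLaw`

**Theorem (Hartman–Watson 1974; Yor 1980).** For every `β > 0` there is a finite positive measure `η` on `(0,∞)`
with `∫ e^{-n²t/2} dη(t) = I_n(β)` for all `n ∈ ℤ` — indeed `∫ e^{-ut} dη(t) = I_{√(2u)}(β)` for all `u ≥ 0`: the function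
`u ↦ I_{√(2u)}(β)` is the Laplace transform of (`I_0(β)` times) the Hartman–Watson law [HartmanWatson1974; Yor1980].

PROOF FORMALISED HERE (analytic, via the Feynman–Kac/Duhamel perturbation series of Bessel-process kernels in the INDEX,
[RevuzYor1999, Ch. XI §1]): with the radial heat kernels `q^{(κ)}_t(x,y) = t⁻¹e^{-(x²+y²)/2t} I_κ(xy/t)` one has
`I_κ(β) = e^{β} q^{(κ)}_1(√β,√β)`, and

1. (`BesselHeatKernelNeumannSeries.exists_hasSum_besselHeatKernel_index`) for every `U > 0` the function
   `Ψ(u) = q^{(√(2u))}_1(√β,√β)` is on `[U/2, U]` a power series `Σ_j m_j (U-u)^j` with `m_j ≥ 0`, `Σ m_j U^j < ∞`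
   (iterated one-step Duhamel identities `q^{(μ)} - q^{(ν)} = (u_ν-u_μ) q^{(ν)}V∗q^{(μ)}`, `u_κ = κ²/2`);
2. (`PowerSeriesNonnegCoeff.completelyMonotone_of_local_powerSeries`) hence `Ψ` is `C^∞` on `(0,∞)` with
   `(-1)^n Ψ^{(n)} ≥ 0`;
3. (`BernsteinCompletelyMonotoneDeriv.exists_measure_laplace_eq_of_iteratedDeriv_alternating`) Bernstein's theorem gives a
   finite measure `μ` on `[0,∞)` with `Ψ(u) = ∫ e^{-us} dμ(s)` (`u > 0`) and `μ[0,∞) = Ψ(0⁺)`;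
4. `Ψ(0⁺) = q^{(0)}_1(√β,√β)` by continuity of `κ ↦ I_κ` at `0⁺` (`tendsto_besselHeatKernel_order_zero`), and `μ{0} = 0`
   because `Ψ(n²/2) = e^{-β} I_n(β) → 0`;
5. `η := e^{β} μ` is the mixing measure: `∫ e^{-n²t/2} dη = e^{β} Ψ(n²/2) = I_{|n|}(β) = I_n(β)`.

Main result: `HartmanWatsonLaw_holds : HartmanWatsonLaw` (the named fact of `VonMisesMixture.lean`, now a theorem), via
`exists_isMixingMeasure`.

## References
* P. Hartman, G. S. Watson, *"Normal" distribution functions on spheres and the modified Bessel functions*, Ann. Probab. 2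
  (1974) 593–607. [HartmanWatson1974]
* M. Yor, *Loi de l'indice du lacet brownien, et distribution de Hartman–Watson*, Z. Wahrsch. 53 (1980) 71–95. [Yor1980]
* D. Revuz, M. Yor, *Continuous Martingales and Brownian Motion*, 3rd ed. (1999), Ch. XI §1. [RevuzYor1999]
-/

noncomputable section

open Filter Topology Real MeasureTheory Set
open scoped NNReal ENNReal BigOperators ContDiff
open Literature.Analysis.SpecialFunctions Literature.Analysis.Calculus Literature.MeasureTheory.Integral
open Literature.Probability.LatticeModels (besselI)

namespace Literature.Probability.HartmanWatson1974

section Laplace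

variable {β : ℝ}

/-- The kernel on the diagonal: `q^{(κ)}_1(√β,√β) = e^{-β} I_κ(β)`. [cite: RevuzYor1999, Ch. XI §1] -/
theorem besselHeatKernel_one_sqrt (hβ : 0 ≤ β) (κ : ℝ) :
    besselHeatKernel κ 1 (Real.sqrt β) (Real.sqrt β) = Real.exp (-β) * besselIR κ β := by
  unfold besselHeatKernel
  rw [Real.sq_sqrt hβ, Real.mul_self_sqrt hβ]
  simp only [inv_one, one_mul, mul_one, div_one]
  congr 1
  ring_nf

/-- **Complete monotonicity of `u ↦ q^{(√(2u))}_1(√β,√β) = e^{-β} I_{√(2u)}(β)`** on `(0,∞)`: it is `C^∞` with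
`(-1)^n (d/du)^n ≥ 0`. [cite: HartmanWatson1974, Theorem (the Laplace transform I_{√(2u)}(r)/I_0(r))] -/
theorem completelyMonotone_besselHeatKernel_index (hβ : 0 < β) :
    ContDiffOn ℝ ∞ (fun u : ℝ => besselHeatKernel (Real.sqrt (2 * u)) 1 (Real.sqrt β) (Real.sqrt β)) (Ioi 0) ∧
      ∀ (n : ℕ) (u : ℝ), 0 < u →
        0 ≤ (-1 : ℝ) ^ n * iteratedDeriv n
          (fun u : ℝ => besselHeatKernel (Real.sqrt (2 * u)) 1 (Real.sqrt β) (Real.sqrt β)) u := by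
  refine completelyMonotone_of_local_powerSeries fun U hU => ?_
  have hsq : 0 < Real.sqrt β := Real.sqrt_pos.2 hβ
  set ν : ℝ := Real.sqrt (2 * U) with hν
  have hν0 : 0 < ν := Real.sqrt_pos.2 (by positivity)
  have hνsq : ν ^ 2 / 2 = U := by rw [hν, Real.sq_sqrt (by positivity)]; ring
  obtain ⟨m, hm0, hms, -, hsum⟩ := exists_hasSum_besselHeatKernel_index hν0 one_pos hsq hsq
  refine ⟨m, hm0, by rwa [hνsq] at hms, fun u hu => ?_⟩
  have h := hsum u (by rw [show ν ^ 2 / 4 = (ν ^ 2 / 2) / 2 by ring, hνsq]; exact hu.1) (by rw [hνsq]; exact hu.2)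
  rwa [hνsq] at h

/-- **Bernstein representation**: for `β > 0` there is a finite measure `μ` on `[0,∞)` with
`q^{(√(2u))}_1(√β,√β) = ∫ e^{-us} dμ(s)` for `u > 0`, total mass `q^{(0)}_1(√β,√β)` and no atom at `0`.
[cite: HartmanWatson1974, Theorem] -/
theorem exists_measure_laplace_besselHeatKernel_index (hβ : 0 < β) :
    ∃ μ : Measure ℝ, IsFiniteMeasure μ ∧ μ (Iic 0) = 0 ∧
      (∀ u : ℝ, 0 < u → besselHeatKernel (Real.sqrt (2 * u)) 1 (Real.sqrt β) (Real.sqrt β) =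
        ∫ s, Real.exp (-(u * s)) ∂μ) ∧
      μ.real univ = besselHeatKernel 0 1 (Real.sqrt β) (Real.sqrt β) := by
  have hsq : 0 < Real.sqrt β := Real.sqrt_pos.2 hβ
  set Ψ : ℝ → ℝ := fun u => besselHeatKernel (Real.sqrt (2 * u)) 1 (Real.sqrt β) (Real.sqrt β) with hΨ
  obtain ⟨hcd, hsign⟩ := completelyMonotone_besselHeatKernel_index hβ
  -- boundedness: `Ψ(u) ≤ q^{(0)}`
  have hbdd : ∃ C : ℝ, ∀ u, 0 < u → Ψ u ≤ C :=
    ⟨besselHeatKernel 0 1 (Real.sqrt β) (Real.sqrt β), fun u _ =>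
      besselHeatKernel_antitone_index le_rfl (Real.sqrt_nonneg _) one_pos hsq hsq⟩
  obtain ⟨μ, hfin, hμ0, hrepr, hlim⟩ := exists_measure_laplace_eq_of_iteratedDeriv_alternating Ψ hcd hsign hbdd
  haveI := hfin
  -- the mass: `Ψ(0⁺) = q^{(0)}`
  have hΨ0 : Tendsto Ψ (𝓝[>] 0) (𝓝 (besselHeatKernel 0 1 (Real.sqrt β) (Real.sqrt β))) := by
    have h1 := tendsto_besselHeatKernel_order_zero one_pos hsq hsq
    have h2 : Tendsto (fun u : ℝ => Real.sqrt (2 * u)) (𝓝[>] 0) (𝓝[>] 0) := by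
      refine tendsto_nhdsWithin_iff.2 ⟨?_, ?_⟩
      · have : Tendsto (fun u : ℝ => Real.sqrt (2 * u)) (𝓝 0) (𝓝 (Real.sqrt (2 * 0))) :=
          (Real.continuous_sqrt.comp (continuous_const.mul continuous_id)).tendsto 0
        rw [mul_zero, Real.sqrt_zero] at this
        exact this.mono_left nhdsWithin_le_nhds
      · exact eventually_nhdsWithin_of_forall fun u (hu : 0 < u) => Real.sqrt_pos.2 (by positivity)
    exact h1.comp h2
  have hmass : μ.real univ = besselHeatKernel 0 1 (Real.sqrt β) (Real.sqrt β) := tendsto_nhds_unique hlim hΨ0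
  -- no atom at `0`: `μ{0} ≤ Ψ(n²/2) = e^{-β} I_n(β) → 0`
  have hatom_le : ∀ u, 0 < u → μ.real {0} ≤ Ψ u := by
    intro u hu
    rw [hrepr u hu]
    have hind : ∀ s, ({0} : Set ℝ).indicator (fun _ => (1 : ℝ)) s ≤ Real.exp (-(u * s)) := by
      intro s
      by_cases hs : s = 0
      · subst hs; simp
      · rw [indicator_of_notMem (by simpa using hs)]; exact (Real.exp_pos _).le
    have hint : Integrable (fun s => Real.exp (-(u * s))) μ := by
      by_contra hni
      have := hrepr u hu
      rw [integral_undef hni] at this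
      exact absurd this (besselHeatKernel_pos (Real.sqrt_nonneg _) one_pos hsq hsq).ne'
    calc μ.real {0} = ∫ s, ({0} : Set ℝ).indicator (fun _ => (1 : ℝ)) s ∂μ := by
          rw [integral_indicator (measurableSet_singleton 0), setIntegral_const, smul_eq_mul, mul_one]
      _ ≤ ∫ s, Real.exp (-(u * s)) ∂μ :=
          integral_mono ((integrable_const 1).indicator (measurableSet_singleton 0)) hint hind
  have hval : ∀ n : ℕ, Ψ ((n : ℝ) ^ 2 / 2) = Real.exp (-β) * besselI n β := by
    intro n
    simp only [hΨ]
    rw [show 2 * ((n : ℝ) ^ 2 / 2) = (n : ℝ) ^ 2 by ring, Real.sqrt_sq n.cast_nonneg,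
      besselHeatKernel_one_sqrt hβ.le, besselIR_natCast]
  have h0 : Tendsto (fun n : ℕ => Real.exp (-β) * besselI n β) atTop (𝓝 0) := by
    have hsum : Summable fun n : ℕ => |besselI n β| :=
      (Literature.Probability.LatticeModels.summable_abs_besselI β).comp_injective Nat.cast_injective
    have h1 : Tendsto (fun n : ℕ => besselI n β) atTop (𝓝 0) :=
      (tendsto_zero_iff_abs_tendsto_zero _).2 hsum.tendsto_atTop_zero
    simpa using h1.const_mul (Real.exp (-β))
  have hΨn : Tendsto (fun n : ℕ => Ψ (((n : ℝ) + 1) ^ 2 / 2)) atTop (𝓝 0) := by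
    refine (h0.comp (tendsto_add_atTop_nat 1)).congr fun n => ?_
    rw [Function.comp_apply, ← hval (n + 1)]
    push_cast
    rfl
  have hatom : μ {0} = 0 := by
    have h1 : μ.real {0} ≤ 0 :=
      ge_of_tendsto' hΨn fun n => hatom_le _ (by positivity)
    have h2 : μ.real {0} = 0 := le_antisymm h1 measureReal_nonneg
    exact (measureReal_eq_zero_iff (measure_ne_top μ _)).1 h2
  refine ⟨μ, hfin, ?_, hrepr, hmass⟩
  rw [← Iio_insert, ← union_singleton]
  exact nonpos_iff_eq_zero.1 ((measure_union_le _ _).trans (by rw [hμ0, hatom, add_zero]))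

end Laplace

/-! ## The mixing measure and the discharge of `HartmanWatsonLaw` -/

section Main

/-- **Existence of a Hartman–Watson mixing measure** for every `β > 0`: `η = e^{β} μ` with `μ` the Bernstein measure of
`u ↦ q^{(√(2u))}_1(√β,√β)`. [cite: HartmanWatson1974, Theorem; density Yor1980] -/
theorem exists_isMixingMeasure {β : ℝ} (hβ : 0 < β) : ∃ η : Measure ℝ, IsMixingMeasure β η := by
  obtain ⟨μ, hfin, hμ0, hrepr, hmass⟩ := exists_measure_laplace_besselHeatKernel_index hβ
  haveI := hfin
  set c : ℝ≥0 := (Real.exp β).toNNReal with hc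
  have hcval : (c : ℝ) = Real.exp β := Real.coe_toNNReal _ (Real.exp_pos β).le
  refine ⟨c • μ, ⟨inferInstance, ?_, fun n => ?_⟩⟩
  · rw [Measure.smul_apply, hμ0, smul_zero]
  · rw [integral_smul_nnreal_measure, NNReal.smul_def, hcval, smul_eq_mul]
    rcases eq_or_ne n 0 with hn | hn
    · subst hn
      simp only [Int.cast_zero, ne_eq, OfNat.ofNat_ne_zero, not_false_eq_true, zero_pow, zero_mul, neg_zero,
        zero_div, Real.exp_zero, integral_const, smul_eq_mul, mul_one]
      rw [show μ.real univ = besselHeatKernel 0 1 (Real.sqrt β) (Real.sqrt β) from hmass,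
        besselHeatKernel_one_sqrt hβ.le, ← mul_assoc, ← Real.exp_add, add_neg_cancel, Real.exp_zero, one_mul,
        show (0 : ℝ) = ((0 : ℕ) : ℝ) by simp, besselIR_natCast]
      simp
    · have hu : 0 < ((n : ℝ)) ^ 2 / 2 := by positivity
      have hint : ∫ t, Real.exp (-(n : ℝ) ^ 2 * t / 2) ∂μ = ∫ t, Real.exp (-((n : ℝ) ^ 2 / 2 * t)) ∂μ := by
        refine integral_congr_ae (Eventually.of_forall fun t => ?_)
        ring_nf
      rw [hint, ← hrepr _ hu, show 2 * ((n : ℝ) ^ 2 / 2) = (n : ℝ) ^ 2 by ring, Real.sqrt_sq_eq_abs,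
        besselHeatKernel_one_sqrt hβ.le, ← mul_assoc, ← Real.exp_add, add_neg_cancel, Real.exp_zero, one_mul,
        show |(n : ℝ)| = ((n.natAbs : ℕ) : ℝ) by rw [← Int.cast_abs, ← Int.natCast_natAbs, Int.cast_natCast],
        besselIR_natCast]
      rcases Int.natAbs_eq n with h | h
      · conv_rhs => rw [h]
      · conv_rhs => rw [h, Literature.Probability.LatticeModels.besselI_neg_index]

/-- **The Hartman–Watson theorem** — discharge of the named fact `HartmanWatsonLaw` of `VonMisesMixture.lean`: for every
`β > 0` there is a Hartman–Watson mixing measure (a finite positive measure `η` on `(0,∞)` with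
`∫ e^{-n²t/2} dη = I_n(β)` for all `n ∈ ℤ`). [cite: HartmanWatson1974, Theorem] -/
theorem HartmanWatsonLaw_holds : HartmanWatsonLaw := fun _ hβ => exists_isMixingMeasure hβ

/-- **The Hartman–Watson theorem, Laplace-transform form**: for `β > 0` there is a Hartman–Watson mixing measure `η` at `β`
(finite, carried by `(0,∞)`, integer Gaussian moments `I_n(β)`) whose Laplace transform is `∫ e^{-ut} dη(t) = I_{√(2u)}(β)` for ALL
real `u ≥ 0` — i.e. `η/I_0(β)` is the Hartman–Watson law `η_β` with `E[e^{-u A}] = I_{√(2u)}(β)/I_0(β)`.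
[cite: HartmanWatson1974, Theorem; Yor1980] -/
theorem exists_isMixingMeasure_laplace {β : ℝ} (hβ : 0 < β) :
    ∃ η : Measure ℝ, IsMixingMeasure β η ∧
      ∀ u : ℝ, 0 ≤ u → ∫ t, Real.exp (-(u * t)) ∂η = besselIR (Real.sqrt (2 * u)) β := by
  obtain ⟨μ, hfin, hμ0, hrepr, hmass⟩ := exists_measure_laplace_besselHeatKernel_index hβ
  haveI := hfin
  set c : ℝ≥0 := (Real.exp β).toNNReal with hc
  have hcval : (c : ℝ) = Real.exp β := Real.coe_toNNReal _ (Real.exp_pos β).le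
  -- the Laplace transform of `c • μ` at every `u ≥ 0`
  have hlap : ∀ u : ℝ, 0 ≤ u → ∫ t, Real.exp (-(u * t)) ∂(c • μ) = besselIR (Real.sqrt (2 * u)) β := by
    intro u hu
    rw [integral_smul_nnreal_measure, NNReal.smul_def, hcval, smul_eq_mul]
    rcases eq_or_lt_of_le hu with h | h
    · subst h
      simp only [zero_mul, neg_zero, Real.exp_zero, integral_const, smul_eq_mul, mul_one, mul_zero, Real.sqrt_zero]
      rw [show μ.real univ = besselHeatKernel 0 1 (Real.sqrt β) (Real.sqrt β) from hmass,
        besselHeatKernel_one_sqrt hβ.le, ← mul_assoc, ← Real.exp_add, add_neg_cancel, Real.exp_zero, one_mul]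
    · rw [← hrepr u h, besselHeatKernel_one_sqrt hβ.le, ← mul_assoc, ← Real.exp_add, add_neg_cancel, Real.exp_zero,
        one_mul]
  refine ⟨c • μ, ⟨inferInstance, ?_, fun n => ?_⟩, hlap⟩
  · rw [Measure.smul_apply, hμ0, smul_zero]
  · have hint : ∫ t, Real.exp (-(n : ℝ) ^ 2 * t / 2) ∂(c • μ) = ∫ t, Real.exp (-((n : ℝ) ^ 2 / 2 * t)) ∂(c • μ) := by
      refine integral_congr_ae (Eventually.of_forall fun t => ?_)
      ring_nf
    rw [hint, hlap _ (by positivity), show 2 * ((n : ℝ) ^ 2 / 2) = (n : ℝ) ^ 2 by ring, Real.sqrt_sq_eq_abs,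
      show |(n : ℝ)| = ((n.natAbs : ℕ) : ℝ) by rw [← Int.cast_abs, ← Int.natCast_natAbs, Int.cast_natCast],
      besselIR_natCast]
    rcases Int.natAbs_eq n with h | h
    · conv_rhs => rw [h]
    · conv_rhs => rw [h, Literature.Probability.LatticeModels.besselI_neg_index]

/-! ## Unconditional forms of the Villain ↔ von Mises dictionary of `VonMisesMixture.lean` -/

/-- **The von Mises (Wilson `U(1)` plaquette) weight is an exact positive mixture of circle heat kernels** — now
unconditional: for every `β > 0` there is a finite measure `η` on `(0,∞)` with `∫ p_t(e^{iθ}) dη(t) = e^{β cos θ}` for all `θ`.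
[cite: HartmanWatson1974, Theorem (von Mises law = Brownian motion on the circle at an independent η-time)] -/
theorem exists_measure_integral_circleHeatKernel {β : ℝ} (hβ : 0 < β) :
    ∃ η : Measure ℝ, IsFiniteMeasure η ∧ η (Iic 0) = 0 ∧
      ∀ θ : ℝ, ∫ t, Literature.MathematicalPhysics.QuantumLattice.circleHeatKernel t (Circle.exp θ) ∂η =
        Real.exp (β * Real.cos θ) := by
  obtain ⟨η, hη⟩ := exists_isMixingMeasure hβ
  exact ⟨η, hη.finite, hη.null_nonpos, fun θ => hη.integral_circleHeatKernel θ⟩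

/-- **Villain form, unconditional**: `∫ √(2π/t) v_{1/t}(θ) dη(t) = e^{β cos θ}` for a finite measure `η` on `(0,∞)`.
[cite: HartmanWatson1974, Theorem] -/
theorem exists_measure_integral_villainKernel {β : ℝ} (hβ : 0 < β) :
    ∃ η : Measure ℝ, IsFiniteMeasure η ∧ η (Iic 0) = 0 ∧
      ∀ θ : ℝ, ∫ t, Real.sqrt (2 * Real.pi * t⁻¹) *
        Literature.MathematicalPhysics.QuantumFieldTheory.villainKernel t⁻¹ θ ∂η = Real.exp (β * Real.cos θ) := by
  obtain ⟨η, hη⟩ := exists_isMixingMeasure hβ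
  exact ⟨η, hη.finite, hη.null_nonpos, fun θ => hη.integral_villainKernel θ⟩

/-- **Annealed dual weights, unconditional**: `∏_p I_{n_p}(β) = ∫ ∏_p e^{-n_p² t_p/2} dη^{⊗P}` for a Hartman–Watson mixing
measure `η` at `β`. [cite: HartmanWatson1974, Theorem] -/
theorem exists_measure_integral_pi_prod_exp {β : ℝ} (hβ : 0 < β) :
    ∃ η : Measure ℝ, IsMixingMeasure β η ∧ ∀ {ι : Type} [Fintype ι] (n : ι → ℤ),
      ∫ t, ∏ p, Real.exp (-(n p : ℝ) ^ 2 * t p / 2) ∂(Measure.pi fun _ : ι => η) = ∏ p, besselI (n p) β := by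
  obtain ⟨η, hη⟩ := exists_isMixingMeasure hβ
  exact ⟨η, hη, fun n => hη.integral_pi_prod_exp n⟩

end Main

end Literature.Probability.HartmanWatson1974

end
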